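import Literature.NumberTheory.Automorphic.BaseChangeStrongAllFiniteRankOne
import Literature.NumberTheory.Automorphic.BaseChangeArchimedeanCentralCharacter
import HarnessLib

/-!
# Arthur–Clozel strong lifting at ALL finite places: the fact at a place RAMIFIED in `E/F`
# (unique place above, `e = ℓ`, `f = 1`; `(χ ∘ N_{E/F})(ϖ_w) = χ(ϖ_v)^{f(w|v)}` at every place;
# the Satake parameter and the Hecke polynomial of the lift are determined)

Topic `NumberTheory/Automorphic`; a proof file (theorems only: no definition, no named fact, no
instance), written for the named fact `ArthurClozel1989_strongLifting_allFinite`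
(`BaseChangeStrongAllFinite`; J. Arthur, L. Clozel, *Simple algebras, base change, and the advanced
theory of the trace formula*, Ann. of Math. Stud. 120 (1989), Ch. 3, Thm. 5.1 with §1 (1.1) and
Ch. 1 §6: for `E/F` Galois of prime degree and cuspidal `π` on `GL_n(𝔸_F)`, `Π` on `GL_n(𝔸_E)` with
`Π` a weak base change lift of `π`, at EVERY finite `w ∣ v` — `v` ramified in `E` allowed — every
Satake parameter `α` of `π` at `v` gives the Satake parameter `α^{f(w|v)}` of `Π` at `w`), next to
`BaseChangeStrongAllFiniteRankOne` (`n = 1`, proved), `BaseChangeStrongUnramifiedUnitaryReduction`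
(`n = 0`; reduction of the fact to clean data with unitary central character) and
`BaseChangeStrongUnramifiedCentralCharacter` (the centre of the fact for every `n`:
`det t_{Π,w} = (det t_{π,v})^{f(w|v)}` at every finite place, unconditionally; not imported here).  For `n ≥ 2` the fact
is the twisted trace formula (Ch. 2, Thms. A–B; Ch. 3, (4.1) and pp. 212–214) with the local base
change of Ch. 1 §6, none of which the tree has; what distinguishes it from its sibling
`ArthurClozel1989_strongLifting_unramified` is the finite set of places of `F` RAMIFIED in `E`, and
this file records, with proof, the shape of the fact there:

* `HeightOneSpectrum.ncard_primesOver_eq_one_of_not_isUnramifiedIn`,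
  `HeightOneSpectrum.eq_of_under_eq_of_not_isUnramifiedIn`,
  `HeightOneSpectrum.ramificationIdxIn_eq_finrank_of_not_isUnramifiedIn` — **a ramified place in
  prime degree `ℓ` is totally ramified**: `g = 1` (the place `w` of `E` above `v` is unique),
  `e = ℓ`, `f = 1` (the last is `HeightOneSpectrum.inertiaDeg_eq_one_of_not_isUnramifiedIn` of
  `BaseChangeStrongAllFinite`); fundamental identity `g e f = ℓ` (Mathlib
  `Ideal.ncard_primesOver_mul_ramificationIdxIn_mul_inertiaDegIn`) and "`e = 1` iff unramified"
  (finite residue fields are perfect, `Algebra.isUnramifiedIn_iff_forall_ramificationIdx_eq_one`).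
* `HeckeCharacter.valueAtUniformizer_baseChange` — **base change of Hecke characters at EVERY
  finite place**: for `E/F` Galois, `χ` unramified at `v` and ANY `w ∣ v` (ramified allowed),
  `(χ ∘ N_{E/F})(ϖ_w) = χ(ϖ_v)^{f(w|v)}` — relation (1.1) for `GL(1)` (Arthur–Clozel, Ch. 1,
  Def. 6.1 for `n = 1`: `Π = π ∘ N`), the pure `GL(1)` form of
  `IsWeakBaseChangeLiftAE.centralCharacter_valueAtUniformizer_eq_pow` of
  `BaseChangeStrongUnramifiedCentralCharacter` (same norm computation:
  `exists_ideleRelNorm_localUnits_eq`, `valued_eq_pow_inertiaDegIn_of_algebraMap_eq_norm_blockHom_localUnits`,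
  `IsUnramifiedAt.map_localUnits_eq_pow` of `BaseChangeStrongAllFiniteRankOne`; Cassels–Fröhlich
  II §11, VII §1.2), stated for a bare Hecke character.
* `IsWeakBaseChangeLiftAE.prod_satakeParam_eq_prod_of_not_isUnramifiedIn` — **`∏ t_{Π,w} =
  ∏ t_{π,v}` at a ramified `v`, unconditionally and for every `n`** (from `ω_Π = ω_π ∘ N_{E/F}`,
  Prop. 4.4 (ii), the previous item and `f(w|v) = 1`; the identity `∏ t_{Π,w} = (∏ t_{π,v})^{f(w|v)}`
  at an arbitrary place is `IsWeakBaseChangeLiftAE.prod_satakeParam_eq_pow` of the sibling proof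
  file `BaseChangeStrongUnramifiedCentralCharacter`).
* `ArthurClozel1989_strongLifting_allFinite.eq_map_pow`, `….hasSatakeParamAt_iff`,
  `….hasSatakeParamAt_iff_of_not_isUnramifiedIn`, `….hasSatakeParamAt_of_under_eq_of_not_isUnramifiedIn`
  — **granted the fact, the Satake parameter of `Π` at `w` is DETERMINED**: `β = α^{f(w|v)}`
  (uniqueness of Satake parameters, Flath 1979, Thm. 3 — the tree's `hasSatakeParamAt_unique_holds`),
  and at the (unique) place over a ramified `v` simply `β = α`: `t_{Π,w} = t_{π,v}`, the Hecke
  eigenvalues of the lift at the ramified places being those of `π` (the reading the requesting crux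
  `ParityBlindBianchi.ResidualBianchiDoorLevel` consumes).
* `ArthurClozel1989_strongLifting_allFinite.hasHeckePolynomialAt`,
  `….hasHeckePolynomialAt_iff_of_not_isUnramifiedIn` — granted the fact, **the Hecke polynomial of
  `Π` at `w` has as roots the `f(w|v)`-th powers of the roots of the Hecke polynomial of `π` at
  `v`** (`q_w = q_v^{f(w|v)}`; the Frobenius compatibility `char(Frob_w) = char(Frob_v^{f})`
  expected of `BC(π)`), and at a ramified `v` the two Hecke polynomials COINCIDE.

Nothing here assumes the fact except the consequences in the namespace
`ArthurClozel1989_strongLifting_allFinite` taking `(h : ArthurClozel1989_strongLifting_allFinite)`;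
no statement of the tree is modified; the discharge `ArthurClozel1989_strongLifting_allFinite_holds`
is not attempted.

## References

* J. Arthur, L. Clozel, *Simple algebras, base change, and the advanced theory of the trace
  formula*, Ann. of Math. Stud. 120 (1989): Ch. 1 §5, §6.1 Def. 6.1, Prop. 6.7; Ch. 3 §1 (1.1),
  Def. 1.1–1.2 (p. 199), Prop. 4.4 (ii) (p. 211), Thm. 5.1 and its proof (pp. 212–214).
  [ArthurClozelAMS120]
* J. W. S. Cassels, A. Fröhlich (eds.), *Algebraic Number Theory* (1967), Ch. I §5–§7 (totally
  ramified extensions), Ch. II §11, Ch. VII §1.2. [CasselsFrohlichANT1967]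
* D. Flath, *Decomposition of representations into tensor products*, Corvallis (1979), Thm. 3.
  [FlathCorvallis1979]
-/

noncomputable section

open scoped MatrixGroups Matrix Classical NumberField
open NumberField IsDedekindDomain Filter

namespace Literature.NumberTheory.Automorphic

open Literature.NumberTheory.GaloisRepresentations

/-! ### §1. A ramified place in prime degree is totally ramified -/

section PrimeDegree

variable {F E : Type*} [Field F] [NumberField F] [Field E] [NumberField E] [Algebra F E]

/-- In a Galois extension `E/F` of prime degree `ℓ`, over a finite place `v` of `F` NOT unramified
in `E` there is exactly one place, with `e = ℓ` and `f = 1`: all `w ∣ v` share `e`, `f` with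
`g e f = ℓ` (fundamental identity), and `e = 1` would make `v` unramified (finite residue fields
are perfect), so `e = ℓ`, `g = f = 1`. [folklore] -/
theorem HeightOneSpectrum.ncard_primesOver_eq_one_of_not_isUnramifiedIn [IsGalois F E]
    (hℓ : (Module.finrank F E).Prime) {v : HeightOneSpectrum (𝓞 F)}
    (hram : ¬ Algebra.IsUnramifiedIn (𝓞 E) v.asIdeal) :
    (v.asIdeal.primesOver (𝓞 E)).ncard = 1 ∧
      v.asIdeal.ramificationIdxIn (𝓞 E) = Module.finrank F E ∧ v.asIdeal.inertiaDegIn (𝓞 E) = 1 := by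
  classical
  haveI : IsGaloisGroup (E ≃ₐ[F] E) (𝓞 F) (𝓞 E) := IsGaloisGroup.of_isFractionRing _ _ _ F E
  haveI : v.asIdeal.IsMaximal := v.isMaximal
  -- `e_v ≠ 1`, for otherwise `v` would be unramified in `E`
  have he : v.asIdeal.ramificationIdxIn (𝓞 E) ≠ 1 := by
    intro h1
    apply hram
    rw [Algebra.isUnramifiedIn_iff_forall_ramificationIdx_eq_one]
    intro Q _ hQ
    haveI := hQ
    rw [← Ideal.ramificationIdxIn_eq_ramificationIdx v.asIdeal Q (E ≃ₐ[F] E)]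
    exact h1
  -- fundamental identity `g e f = ℓ`
  have hfund := Ideal.ncard_primesOver_mul_ramificationIdxIn_mul_inertiaDegIn v.asIdeal (𝓞 E)
    (E ≃ₐ[F] E)
  rw [IsGalois.card_aut_eq_finrank] at hfund
  have hediv : v.asIdeal.ramificationIdxIn (𝓞 E) ∣ Module.finrank F E :=
    ⟨(v.asIdeal.primesOver (𝓞 E)).ncard * v.asIdeal.inertiaDegIn (𝓞 E), by
      rw [← hfund]; ring⟩
  have heℓ : v.asIdeal.ramificationIdxIn (𝓞 E) = Module.finrank F E :=
    ((Nat.dvd_prime hℓ).1 hediv).resolve_left he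
  have hpos : 0 < Module.finrank F E := Module.finrank_pos
  have hgf : (v.asIdeal.primesOver (𝓞 E)).ncard * v.asIdeal.inertiaDegIn (𝓞 E) = 1 := by
    have h2 : (v.asIdeal.primesOver (𝓞 E)).ncard * v.asIdeal.inertiaDegIn (𝓞 E) *
        Module.finrank F E = 1 * Module.finrank F E := by
      rw [one_mul]
      calc (v.asIdeal.primesOver (𝓞 E)).ncard * v.asIdeal.inertiaDegIn (𝓞 E) * Module.finrank F E
          = (v.asIdeal.primesOver (𝓞 E)).ncard * (v.asIdeal.ramificationIdxIn (𝓞 E) *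
              v.asIdeal.inertiaDegIn (𝓞 E)) := by rw [heℓ]; ring
        _ = Module.finrank F E := hfund
    exact Nat.eq_of_mul_eq_mul_right hpos h2
  exact ⟨Nat.eq_one_of_mul_eq_one_right hgf, heℓ, Nat.eq_one_of_mul_eq_one_left hgf⟩

/-- **Uniqueness of the place above a ramified place in prime degree.**  If `E/F` is Galois of
prime degree and `v` is not unramified in `E`, any two places `w, w'` of `E` above `v` coincide
(`g = 1`: `v` is totally ramified). [folklore] -/
theorem HeightOneSpectrum.eq_of_under_eq_of_not_isUnramifiedIn [IsGalois F E]
    (hℓ : (Module.finrank F E).Prime) {v : HeightOneSpectrum (𝓞 F)}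
    {w w' : HeightOneSpectrum (𝓞 E)} (hw : w.asIdeal.under (𝓞 F) = v.asIdeal)
    (hw' : w'.asIdeal.under (𝓞 F) = v.asIdeal) (hram : ¬ Algebra.IsUnramifiedIn (𝓞 E) v.asIdeal) :
    w = w' := by
  obtain ⟨h1, -, -⟩ := HeightOneSpectrum.ncard_primesOver_eq_one_of_not_isUnramifiedIn hℓ hram
  obtain ⟨Q, hQ⟩ := Set.ncard_eq_one.1 h1
  have hmem : ∀ {u : HeightOneSpectrum (𝓞 E)}, u.asIdeal.under (𝓞 F) = v.asIdeal →
      u.asIdeal ∈ v.asIdeal.primesOver (𝓞 E) := fun {u} hu => ⟨u.isPrime, ⟨hu.symm⟩⟩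
  have e1 : w.asIdeal = Q := by simpa [hQ] using hmem hw
  have e2 : w'.asIdeal = Q := by simpa [hQ] using hmem hw'
  exact HeightOneSpectrum.ext (e1.trans e2.symm)

/-- **`e(w|v) = ℓ` over a ramified place in prime degree `ℓ`** (the common ramification index
`e_v` of the places above `v`, Mathlib's `Ideal.ramificationIdxIn`). [folklore] -/
theorem HeightOneSpectrum.ramificationIdxIn_eq_finrank_of_not_isUnramifiedIn [IsGalois F E]
    (hℓ : (Module.finrank F E).Prime) {v : HeightOneSpectrum (𝓞 F)}
    (hram : ¬ Algebra.IsUnramifiedIn (𝓞 E) v.asIdeal) :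
    v.asIdeal.ramificationIdxIn (𝓞 E) = Module.finrank F E :=
  (HeightOneSpectrum.ncard_primesOver_eq_one_of_not_isUnramifiedIn hℓ hram).2.1

end PrimeDegree

/-! ### §2. `(χ ∘ N_{E/F})(ϖ_w) = χ(ϖ_v)^{f(w|v)}` at every finite place -/

section GLOne

variable {F E : Type} [Field F] [NumberField F] [Field E] [NumberField E] [Algebra F E]
  [IsGalois F E]

/-- **Relation (1.1) for `GL(1)` at EVERY finite place.**  Let `E/F` be Galois, `χ` a Hecke
character of `F` unramified at the finite place `v`, and `w` ANY place of `E` above `v` (`v` may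
ramify in `E`).  Then `(χ ∘ N_{E/F})(ϖ_w) = χ(ϖ_v)^{f(w|v)}`: the idelic norm of the local idele
`⟨ϖ_w⟩_w` is a local idele `⟨c⟩_v` (`exists_ideleRelNorm_localUnits_eq`; Cassels–Fröhlich II §11,
`(N_{E/F} y)_v = ∏_{w∣v} N_{E_w/F_v} y_w`) with `|c|_v = |ϖ_w|_w^{f_v} = |ϖ_v|_v^{f(w|v)}`
(`valued_eq_pow_inertiaDegIn_of_algebraMap_eq_norm_blockHom_localUnits`), and the unramified `χ_v`
factors through the valuation (`IsUnramifiedAt.map_localUnits_eq_pow`).  (Arthur–Clozel, Ch. 1,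
Def. 6.1 for `n = 1`: the lift of `π_v` is `π_v ∘ N_{E_w/F_v}`; Ch. 3 §1 (1.1).)
[cite: ArthurClozelAMS120, Ch. 3, §1 (1.1) with Ch. 1 Def. 6.1 and §5] -/
theorem _root_.Literature.NumberTheory.GaloisRepresentations.HeckeCharacter.valueAtUniformizer_baseChange
    (χ : HeckeCharacter F) {v : HeightOneSpectrum (𝓞 F)} (hur : χ.IsUnramifiedAt v)
    {w : HeightOneSpectrum (𝓞 E)} (hwv : w.asIdeal.under (𝓞 F) = v.asIdeal) :
    (χ.baseChange E).valueAtUniformizer w =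
      χ.valueAtUniformizer v ^ w.asIdeal.inertiaDeg (𝓞 F) := by
  have hwv' : w.under (𝓞 F) = v := by
    rw [HeightOneSpectrum.ext_iff, HeightOneSpectrum.under_asIdeal]
    exact hwv
  haveI iw : w.asIdeal.LiesOver v.asIdeal := ⟨hwv.symm⟩
  haveI : IsGaloisGroup (E ≃ₐ[F] E) (𝓞 F) (𝓞 E) := IsGaloisGroup.of_isFractionRing _ _ _ F E
  have hfIn : v.asIdeal.inertiaDegIn (𝓞 E) = w.asIdeal.inertiaDeg (𝓞 F) :=
    Ideal.inertiaDegIn_eq_inertiaDeg v.asIdeal w.asIdeal (E ≃ₐ[F] E)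
  -- `N_{E/F} ⟨ϖ_w⟩ = ⟨c⟩_v` with `|c|_v = |ϖ_v|^{f}`
  obtain ⟨c, hc, hrel⟩ :=
    exists_ideleRelNorm_localUnits_eq (F := F) hwv' (HeckeCharacter.uniformizer E w)
  have hcval : Valued.v (c : v.adicCompletion F) =
      Valued.v (HeckeCharacter.uniformizer F v : v.adicCompletion F) ^
        w.asIdeal.inertiaDeg (𝓞 F) := by
    rw [valued_eq_pow_inertiaDegIn_of_algebraMap_eq_norm_blockHom_localUnits hwv'
        (HeckeCharacter.uniformizer E w) hc, hfIn,
      HeckeCharacter.valued_uniformizer, HeckeCharacter.valued_uniformizer]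
  -- `χ_E(ϖ_w) = χ(N ⟨ϖ_w⟩) = χ(⟨c⟩_v) = χ(ϖ_v)^f`
  have hval : (((χ.baseChange E) (localUnits w (HeckeCharacter.uniformizer E w)) : ℂˣ) : ℂ) =
      ((χ (localUnits v (HeckeCharacter.uniformizer F v)) : ℂˣ) : ℂ) ^
        w.asIdeal.inertiaDeg (𝓞 F) := by
    rw [HeckeCharacter.baseChange_apply, hrel,
      hur.map_localUnits_eq_pow c (HeckeCharacter.uniformizer F v) hcval, Units.val_pow_eq_pow_val]
  unfold HeckeCharacter.valueAtUniformizer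
  rw [HeckeCharacter.localComponent_apply, HeckeCharacter.localComponent_apply]
  exact hval

end GLOne

/-! ### §3. The determinant of (1.1) at a ramified place: `∏ t_{Π,w} = ∏ t_{π,v}` -/

section Centre

variable {F E : Type} [Field F] [NumberField F] [Field E] [NumberField E] [Algebra F E]
  [IsGalois F E] {n : ℕ} {hF : isCompact_glFiniteIntegralLevel n F}
  {hE : isCompact_glFiniteIntegralLevel n E}

/-- **At a place ramified in `E/F` the lift has the same `det t`, unconditionally and for every
`n`.**  If `Π` is a weak base change lift of `π` (arbitrary automorphic representation data on
`GL_n`) over a Galois `E/F` of prime degree, `v` is NOT unramified in `E`, `w ∣ v`, and `α`, `β` are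
Satake parameters of `π` at `v`, `Π` at `w`, then `∏ β = ∏ α`: the central characters satisfy
`ω_Π = ω_π ∘ N_{E/F}` (Ch. 3, Prop. 4.4 (ii) — `centralCharacter_eq_baseChange_of_isWeakBaseChangeLiftAE`),
their Satake shadows are `ω(ϖ) = ∏ t` (`AutomorphicRepData.exists_centralCharacter`),
`(ω_π ∘ N)(ϖ_w) = ω_π(ϖ_v)^{f(w|v)}` (`HeckeCharacter.valueAtUniformizer_baseChange`) and
`f(w|v) = 1` (`HeightOneSpectrum.inertiaDeg_eq_one_of_not_isUnramifiedIn`).  The identity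
`∏ β = (∏ α)^{f(w|v)}` at an arbitrary `w ∣ v` is `IsWeakBaseChangeLiftAE.prod_satakeParam_eq_pow`
of `BaseChangeStrongUnramifiedCentralCharacter`; this is its reading at the places proper to
`ArthurClozel1989_strongLifting_allFinite`, the `e_n`-component of what the fact asserts there
(`β = α`, `ArthurClozel1989_strongLifting_allFinite.hasSatakeParamAt_iff_of_not_isUnramifiedIn`).
[cite: ArthurClozelAMS120, Ch. 3, Prop. 4.4 (ii) with §1 (1.1) and Thm. 5.1] -/
theorem IsWeakBaseChangeLiftAE.prod_satakeParam_eq_prod_of_not_isUnramifiedIn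
    (hℓ : (Module.finrank F E).Prime) {π : AutomorphicRepData (AutomorphyDatum.gl n F hF)}
    {P : AutomorphicRepData (AutomorphyDatum.gl n E hE)} (h : IsWeakBaseChangeLiftAE π P)
    {w : HeightOneSpectrum (𝓞 E)} {v : HeightOneSpectrum (𝓞 F)}
    (hwv : w.asIdeal.under (𝓞 F) = v.asIdeal) (hram : ¬ Algebra.IsUnramifiedIn (𝓞 E) v.asIdeal)
    {α β : Multiset ℂ} (hα : π.HasSatakeParamAt v α) (hβ : P.HasSatakeParamAt w β) :
    β.prod = α.prod := by
  obtain ⟨ωπ, -, hωπ⟩ := π.exists_centralCharacter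
  obtain ⟨ωP, -, hωP⟩ := P.exists_centralCharacter
  have hbc : ωP = ωπ.baseChange E :=
    AutomorphicRepData.centralCharacter_eq_baseChange_of_isWeakBaseChangeLiftAE
      (fun hα' => hωπ hα') (fun hβ' => hωP hβ') h
  rw [← (hωP hβ).2, ← (hωπ hα).2, hbc, ωπ.valueAtUniformizer_baseChange (hωπ hα).1 hwv,
    HeightOneSpectrum.inertiaDeg_eq_one_of_not_isUnramifiedIn hℓ hwv hram, pow_one]

end Centre

/-! ### §4. With the binders of the fact -/

namespace ArthurClozel1989_strongLifting_allFinite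

variable {n : ℕ} {F E : Type} [Field F] [NumberField F] [Field E] [NumberField E] [Algebra F E]
  [IsGalois F E] {hF : isCompact_glFiniteIntegralLevel n F} {hE : isCompact_glFiniteIntegralLevel n E}
  {π : CuspidalAutomorphicRepData n F hF} {P : CuspidalAutomorphicRepData n E hE}

/-- **Granted the fact, the Satake parameter of the lift at `w` is determined**: if `Π` has Satake
parameter `β` at `w ∣ v` and `π` has `α` at `v`, then `β = α^{f(w|v)}` (the fact gives
`α^{f(w|v)}` at `w`; Satake parameters are unique, Flath 1979, Thm. 3 —
`hasSatakeParamAt_unique_holds`). [cite: ArthurClozelAMS120, Ch. 3 Thm. 5.1 with §1 (1.1)]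
[cite: FlathCorvallis1979, Thm. 3] -/
theorem eq_map_pow (h : ArthurClozel1989_strongLifting_allFinite)
    (hl : (Module.finrank F E).Prime) (hlift : IsWeakBaseChangeLiftAE π.1 P.1)
    {w : HeightOneSpectrum (𝓞 E)} {v : HeightOneSpectrum (𝓞 F)}
    (hwv : w.asIdeal.under (𝓞 F) = v.asIdeal) {α β : Multiset ℂ} (hα : π.1.HasSatakeParamAt v α)
    (hβ : P.1.HasSatakeParamAt w β) :
    β = α.map (· ^ w.asIdeal.inertiaDeg (𝓞 F)) :=
  P.1.hasSatakeParamAt_unique_holds hβ (h n F E hl hF hE π P hlift w v α hwv hα)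

/-- **Granted the fact, `t_{Π,w}` is exactly `t_{π,v}^{f(w|v)}`**: for `π` with Satake parameter `α`
at `v` and any `w ∣ v`, `Π` has Satake parameter `β` at `w` iff `β = α^{f(w|v)}`.
[cite: ArthurClozelAMS120, Ch. 3 Thm. 5.1 with §1 (1.1)] [cite: FlathCorvallis1979, Thm. 3] -/
theorem hasSatakeParamAt_iff (h : ArthurClozel1989_strongLifting_allFinite)
    (hl : (Module.finrank F E).Prime) (hlift : IsWeakBaseChangeLiftAE π.1 P.1)
    {w : HeightOneSpectrum (𝓞 E)} {v : HeightOneSpectrum (𝓞 F)}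
    (hwv : w.asIdeal.under (𝓞 F) = v.asIdeal) {α : Multiset ℂ} (hα : π.1.HasSatakeParamAt v α)
    (β : Multiset ℂ) :
    P.1.HasSatakeParamAt w β ↔ β = α.map (· ^ w.asIdeal.inertiaDeg (𝓞 F)) := by
  refine ⟨fun hβ => eq_map_pow h hl hlift hwv hα hβ, ?_⟩
  rintro rfl
  exact h n F E hl hF hE π P hlift w v α hwv hα

/-- **At a place ramified in `E/F` the lift has EXACTLY the Satake parameter of `π`** (granted the
fact): `Π` has Satake parameter `β` at the place `w` over a ramified `v` iff `β = α`, `α` being the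
Satake parameter of `π` at `v` (`f(w|v) = 1`). [cite: ArthurClozelAMS120, Ch. 3 Thm. 5.1 and its proof (pp. 212–214)]
[cite: FlathCorvallis1979, Thm. 3] -/
theorem hasSatakeParamAt_iff_of_not_isUnramifiedIn (h : ArthurClozel1989_strongLifting_allFinite)
    (hl : (Module.finrank F E).Prime) (hlift : IsWeakBaseChangeLiftAE π.1 P.1)
    {w : HeightOneSpectrum (𝓞 E)} {v : HeightOneSpectrum (𝓞 F)}
    (hwv : w.asIdeal.under (𝓞 F) = v.asIdeal) (hram : ¬ Algebra.IsUnramifiedIn (𝓞 E) v.asIdeal)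
    {α : Multiset ℂ} (hα : π.1.HasSatakeParamAt v α) (β : Multiset ℂ) :
    P.1.HasSatakeParamAt w β ↔ β = α := by
  rw [hasSatakeParamAt_iff h hl hlift hwv hα,
    HeightOneSpectrum.inertiaDeg_eq_one_of_not_isUnramifiedIn hl hwv hram,
    show (α.map (· ^ (1 : ℕ))) = α by simp]

/-- **Over a ramified `v` there is only one local datum of `Π`**: if `w`, `w'` both lie over a
place `v` not unramified in `E` (prime degree), a Satake parameter of `Π` at `w'` is one at `w`,
because `w = w'` (`HeightOneSpectrum.eq_of_under_eq_of_not_isUnramifiedIn`) — so the relation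
(1.1) "for every `w ∣ v`" of Def. 1.2 is a single condition at a ramified `v`. [folklore] -/
theorem hasSatakeParamAt_of_under_eq_of_not_isUnramifiedIn
    (hl : (Module.finrank F E).Prime) {w w' : HeightOneSpectrum (𝓞 E)} {v : HeightOneSpectrum (𝓞 F)}
    (hwv : w.asIdeal.under (𝓞 F) = v.asIdeal) (hw'v : w'.asIdeal.under (𝓞 F) = v.asIdeal)
    (hram : ¬ Algebra.IsUnramifiedIn (𝓞 E) v.asIdeal) {β : Multiset ℂ}
    (hβ : P.1.HasSatakeParamAt w' β) : P.1.HasSatakeParamAt w β := by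
  rwa [HeightOneSpectrum.eq_of_under_eq_of_not_isUnramifiedIn hl hwv hw'v hram]

/-! ### §5. Hecke polynomials: the roots at `w` are the `f(w|v)`-th powers of the roots at `v` -/

omit [IsGalois F E] in
/-- `q_w = q_v^{f(w|v)}` for finite places `w ∣ v` of `E ⊇ F` (Mathlib `Ideal.inertiaDeg_eq_of_isMaximal`
and `Module.natCard_eq_pow_finrank`; a copy of the private lemma of
`BaseChangeStrongUnramifiedUnitaryReduction`). [folklore] -/
private theorem residueCard_eq_pow_inertiaDeg_of_under_eq'
    {v : HeightOneSpectrum (𝓞 F)} {w : HeightOneSpectrum (𝓞 E)} (hw : w.asIdeal.under (𝓞 F) = v.asIdeal) :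
    w.residueCard = v.residueCard ^ w.asIdeal.inertiaDeg (𝓞 F) := by
  rw [HeightOneSpectrum.residueCard_eq_card_quotient, HeightOneSpectrum.residueCard_eq_card_quotient]
  haveI : w.asIdeal.IsMaximal := w.isMaximal
  haveI : v.asIdeal.IsMaximal := v.isMaximal
  haveI : w.asIdeal.LiesOver v.asIdeal := ⟨hw.symm⟩
  letI : Field (𝓞 F ⧸ v.asIdeal) := Ideal.Quotient.field _
  rw [Ideal.inertiaDeg_eq_of_isMaximal v.asIdeal w.asIdeal,
    Module.natCard_eq_pow_finrank (K := 𝓞 F ⧸ v.asIdeal)]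

/-- `√(q^k) = (√q)^k` for `q ≥ 0`. [folklore] -/
private theorem sqrt_natCast_pow' (q k : ℕ) :
    Real.sqrt ((q ^ k : ℕ) : ℝ) = Real.sqrt (q : ℝ) ^ k := by
  have hq : (0 : ℝ) ≤ q := Nat.cast_nonneg q
  have h2 : (Real.sqrt (q : ℝ) ^ k) ^ 2 = ((q ^ k : ℕ) : ℝ) := by
    rw [Nat.cast_pow, ← pow_mul, mul_comm, pow_mul, Real.sq_sqrt hq]
  rw [← h2, Real.sqrt_sq (pow_nonneg (Real.sqrt_nonneg _) k)]

/-- **Granted the fact, the Hecke polynomial of `Π` at `w` is `∏_γ (X - γ^{f(w|v)})` over the roots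
`γ = q_v^{(n-1)/2} a` (`a ∈ t_{π,v}`) of the Hecke polynomial of `π` at `v`** — at EVERY finite
`w ∣ v` with `π_v` unramified, ramified `v` allowed: the expected Frobenius compatibility
`char(Frob_w) = char(Frob_v^{f(w|v)})` of the Galois representations attached to `Π = BC(π)` and
`π` (`HasHeckePolynomialAt`: the polynomial with roots `q^{(n-1)/2} t`, Clozel 1990, §3.3).  From
`t_{Π,w} = t_{π,v}^{f(w|v)}` (the fact) and `q_w^{(n-1)/2} a^{f} = (q_v^{(n-1)/2} a)^{f}`
(`q_w = q_v^{f(w|v)}`). [cite: ArthurClozelAMS120, Ch. 3 Thm. 5.1 with §1 (1.1)] -/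
theorem hasHeckePolynomialAt (h : ArthurClozel1989_strongLifting_allFinite)
    (hl : (Module.finrank F E).Prime) (hlift : IsWeakBaseChangeLiftAE π.1 P.1)
    {w : HeightOneSpectrum (𝓞 E)} {v : HeightOneSpectrum (𝓞 F)}
    (hwv : w.asIdeal.under (𝓞 F) = v.asIdeal) {α : Multiset ℂ} (hα : π.1.HasSatakeParamAt v α) :
    P.1.HasHeckePolynomialAt w (satakePolynomial
      ((α.map fun a => (((Real.sqrt (v.residueCard : ℝ)) : ℝ) : ℂ) ^ (n - 1) * a).map
        (· ^ w.asIdeal.inertiaDeg (𝓞 F)))) := by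
  refine ⟨_, h n F E hl hF hE π P hlift w v α hwv hα, ?_⟩
  congr 1
  rw [Multiset.map_map, Multiset.map_map]
  refine Multiset.map_congr rfl fun a _ => ?_
  simp only [Function.comp_apply]
  rw [residueCard_eq_pow_inertiaDeg_of_under_eq' hwv, sqrt_natCast_pow', Complex.ofReal_pow,
    mul_pow, ← pow_mul, ← pow_mul, mul_comm (w.asIdeal.inertiaDeg (𝓞 F)) (n - 1)]

/-- **Granted the fact, at a place RAMIFIED in `E/F` the lift has the SAME Hecke polynomial as
`π`**: if `v` is not unramified in `E` (prime degree: `f(w|v) = 1`, `q_w = q_v`), `w ∣ v`, and `π`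
is unramified at `v`, then `Π` has Hecke polynomial `Q` at `w` iff `π` has Hecke polynomial `Q` at
`v` — the Frobenius characteristic polynomials of `BC(π)` at the ramified places are those of `π`
(`t_{Π,w} = t_{π,v}`, `hasSatakeParamAt_iff_of_not_isUnramifiedIn`).
[cite: ArthurClozelAMS120, Ch. 3 Thm. 5.1 and its proof (pp. 212–214)] [cite: FlathCorvallis1979, Thm. 3] -/
theorem hasHeckePolynomialAt_iff_of_not_isUnramifiedIn (h : ArthurClozel1989_strongLifting_allFinite)
    (hl : (Module.finrank F E).Prime) (hlift : IsWeakBaseChangeLiftAE π.1 P.1)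
    {w : HeightOneSpectrum (𝓞 E)} {v : HeightOneSpectrum (𝓞 F)}
    (hwv : w.asIdeal.under (𝓞 F) = v.asIdeal) (hram : ¬ Algebra.IsUnramifiedIn (𝓞 E) v.asIdeal)
    (hπ : π.1.IsUnramifiedAt v) (Q : Polynomial ℂ) :
    P.1.HasHeckePolynomialAt w Q ↔ π.1.HasHeckePolynomialAt v Q := by
  obtain ⟨α, hα⟩ := hπ
  have hq : w.residueCard = v.residueCard := by
    rw [residueCard_eq_pow_inertiaDeg_of_under_eq' hwv,
      HeightOneSpectrum.inertiaDeg_eq_one_of_not_isUnramifiedIn hl hwv hram, pow_one]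
  constructor
  · rintro ⟨β, hβ, rfl⟩
    rw [hasSatakeParamAt_iff_of_not_isUnramifiedIn h hl hlift hwv hram hα] at hβ
    subst hβ
    exact ⟨β, hα, by rw [hq]⟩
  · rintro ⟨α', hα', rfl⟩
    refine ⟨α', (hasSatakeParamAt_iff_of_not_isUnramifiedIn h hl hlift hwv hram hα α').2 ?_, by rw [hq]⟩
    exact π.1.hasSatakeParamAt_unique_holds hα' hα

end ArthurClozel1989_strongLifting_allFinite

end Literature.NumberTheory.Automorphic

end
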